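import Summits.QuantumFields.YangMills.Theorems.AllWindowsColdBoxBoxHighLineK3PrimeRowE1WilsonRow
import Summits.QuantumFields.YangMills.Theorems.AllWindowsColdBoxBoxHighLineK3PrimeRowE1Phi
import Summits.QuantumFields.YangMills.Theorems.AllWindowsColdBoxBoxHighLineConnectedThreePointRowsTiltU
import Summits.QuantumFields.YangMills.Theorems.AllWindowsColdBoxBoxHighLinePhiQuarticLocalForm

/-!
# U5 K3′ — the hypothesis `hE1r` of the hK3 ROW SUM, BY NAME: the two exact quartic-vertex rows (Wilson `−W₄^{poly}` and `−β·phiQuartic`) summed in the per-row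
# `hKk` currency (planner ym-idea-2 g19 OWNER TABLE 2026-08-30T02:15:47Z «w3 = owner of the hE1r ADAPTER 'K3RowSum.rowBound_E1r'»; LINE-20 U5 ⟨stmt-QuantumFields-24336⟩)

Width seat `ym-line-sfw-p2-w3` (g42), cell ym-idea-1.  fcl-p3 g27's ✓`K3RowSum.tiltCum3_cutSet_size_of_rows (Vr) (mVr) (bVr) (hE1r) …` takes the even polynomial
quartic vertex `Vr β H a := −W4 β H a − β·phiQuartic H a` (`W4 β H a = β·Σ_{z touching} Σ_{ijkl} Q_{ijkl}(v^z_i·v^z_j)(v^z_k·v^z_l)`, `Q` the quartic tensor of record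
✓`WilsonTaylor.exists_quarticTensor_quarticWilson` / ✓`K3RowSum.hW4_of_record`, `|Q| ≤ 1/2`) and asks for `hE1r : |κ₃^{μ_D}(Lx, Ly; Vr β H)| ≤ K β H` with the budget
`β²H⁸K → 0`.  This file supplies it for the GENERIC bounded pair tensor (`∀ B Q, |Q| ≤ B`):

★★ `K3RowSum.rowBound_E1r` — `hE1r` VERBATIM at `Vr β H := fun a => −(β·Σ_z Σ Q…(plaqVar_z a)) − β·phiQuartic H a`, from
* this seat's ✓`K3RowSum.rowBound_E1_wilson` (p756525; Wilson half, `q := 1`, rows [8θ−1], [12θ−3/2]),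
* w2 g33's ✓`GaussRestrict.abs_tiltCum3_muSet_linCurvSq_linCurvSq_const_mul_phiQuartic_le` (p756452) at `c := −β` through this seat's generic
  ✓`K3RowSum.rowBound_of_quadSize'` (Φ half, `q := 1`, same rows) — inlined, no second Φ-row declaration,
* fcl-p3 g27's split ✓`GaussNormalForm.abs_tiltCum3_muSet_linCurvSq_add_third_le` (measurability: ✓`polyCert_quarticPairVertex`, ✓`PhiQuartic.measurable_phiQuartic`; sup on
  `D ⊆ smallField s`: ✓`WilsonTaylor.abs_quarticPairSum_le`, ✓`PhiQuartic.abs_phiQuartic_le_of_mem_smallField`);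
`q := max q_W q_Φ`, `K := K_W + K_Φ`, `β₀ := max`.  Instantiation in the ROW SUM: `hE1r := K3RowSum.rowBound_E1r (1/2) Q hQ`.

No definitions; tree only; standard axioms.  HONEST LABEL: helper-grade U5 bookkeeping (one named hypothesis of hK3 by name; hK3 itself is NOT proved — hRB remains); U5,
⟨stmt-QuantumFields-24336⟩, ⟨24004⟩ and this seat's crux ⟨22884⟩ remain OPEN; route AllWindowsColdBox is DRAFT; no crux, rung or summit is proved; **the Yang–Mills mass gap is
NOT proved by this file; no summit is proved by a line.**
-/

set_option autoImplicit false

noncomputable section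

open MeasureTheory

open Literature.Probability.LatticeModels (Site)
open Literature.MathematicalPhysics.QuantumLattice (ZdPlaquette plaquettesTouching)
open Literature.MathematicalPhysics.QuantumFieldTheory.AxialGauge (boxEdges)
open Summit.QuantumFields.YangMills.Theorems.WeakCouplingRates (plaq12At)

namespace Summit.QuantumFields.YangMills.Theorems.AllWindowsColdBoxBoxHighLine

namespace K3RowSum

open AssemblyBudget ErrorBudget

/-- ★★ **`hE1r` of the hK3 ROW SUM, BY NAME**: the Wilson-quartic and the `Φ`-quartic exact rows summed, at `Vr β H a := −(β·Σ_z Σ Q…) − β·phiQuartic H a`, for every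
bounded pair tensor `|Q_{ijkl}| ≤ B` (see the module docstring). -/
theorem rowBound_E1r : ∀ θ : ℝ, 0 < θ → θ < 1 / 10 → ∀ B : ℝ, ∀ Q : Fin 4 → Fin 4 → Fin 4 → Fin 4 → ℝ, (∀ i j k l, |Q i j k l| ≤ B) →
    ∃ q : ℝ, ∃ K : ℝ → ℕ → ℝ,
      (∃ β₀ : ℝ, 1 ≤ β₀ ∧ ∀ β : ℝ, β₀ ≤ β → ∀ H : ℕ, 1 ≤ H → β ^ θ ≤ (H : ℝ) → (H : ℝ) ≤ β ^ θ + 1 →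
        ∀ D : Set (LandauFree H → E3), MeasurableSet D → D ⊆ smallField H (β ^ ((1 / 8 - θ / 4) - 1 / 2)) → (∀ a, -a ∈ D ↔ a ∈ D) →
        gaussAvg β H (fun a => 1 - D.indicator (fun _ => (1 : ℝ)) a) ≤ β ^ (-q) →
        gaussAvg β H (fun a => 1 - D.indicator (fun _ => (1 : ℝ)) a) ≤ 1 / 2 → (∀ a ∈ D, |tiltU β H a| ≤ 2) → ∀ x y : Site 4,
        |Tilt.tiltCum3 (((volume : Measure (LandauFree H → E3)).restrict D).withDensity fun a => ENNReal.ofReal (gaussWeight β H a))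
            (fun a => -(β * ∑ z ∈ plaquettesTouching (boxEdges 4 (2 * H + 1)), ∑ i : Fin 4, ∑ j : Fin 4, ∑ k : Fin 4, ∑ l : Fin 4, Q i j k l *
              ((WithLp.ofLp (plaqVar H z.1 z.2.1.1 z.2.1.2 a i) ⬝ᵥ WithLp.ofLp (plaqVar H z.1 z.2.1.1 z.2.1.2 a j)) *
                (WithLp.ofLp (plaqVar H z.1 z.2.1.1 z.2.1.2 a k) ⬝ᵥ WithLp.ofLp (plaqVar H z.1 z.2.1.1 z.2.1.2 a l)))) - β * phiQuartic H a) 0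
            (linCurvSq H (plaq12At x)) (linCurvSq H (plaq12At y))| ≤ K β H) ∧
      (∀ ε : ℝ, 0 < ε → ∃ β₀ : ℝ, 1 ≤ β₀ ∧ ∀ β : ℝ, β₀ ≤ β → ∀ H : ℕ, 1 ≤ H → (H : ℝ) ≤ β ^ θ + 1 → β ^ 2 * (H : ℝ) ^ 8 * K β H ≤ ε) := by
  intro θ hθ hθ' B Q hQ
  classical
  -- the Wilson half (this seat's row, by name)
  obtain ⟨q₁, K₁, ⟨β₁, hβ₁, hR₁⟩, hB₁⟩ := rowBound_E1_wilson θ hθ hθ' B Q hQ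
  -- the Φ half: w2 g33's row at `c := −β`, through the generic `β`-dependent adapter
  obtain ⟨CΦ, -, hΦ⟩ := GaussRestrict.abs_tiltCum3_muSet_linCurvSq_linCurvSq_const_mul_phiQuartic_le
  have hVΦ : ∀ H : ℕ, 1 ≤ H → ∀ β : ℝ, 0 < β → ∀ x y : Site 4, ∀ μ₁ ν₁ μ₂ ν₂ : Fin 4, ∀ s : ℝ, 0 ≤ s → ∀ D : Set (LandauFree H → E3), MeasurableSet D →
      D ⊆ smallField H s → ∀ τ : ℝ, gaussAvg β H (fun a => 1 - D.indicator (fun _ => (1 : ℝ)) a) ≤ τ → τ ≤ 1 / 2 →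
      |Tilt.tiltCum3 ((((volume : Measure (LandauFree H → E3)).restrict D).withDensity fun a => ENNReal.ofReal (gaussWeight β H a)))
          ((fun (β : ℝ) (H : ℕ) (a : LandauFree H → E3) => -(β * phiQuartic H a)) β H) 0 (linCurvSq H (x, μ₁, ν₁)) (linCurvSq H (y, μ₂, ν₂))| ≤
        β⁻¹ ^ 3 * (CΦ * (1 + Real.log H) ^ 5 * (1 + Real.sqrt τ * (H : ℝ) ^ 4)) := by
    intro H hH β hβ x y μ₁ ν₁ μ₂ ν₂ s hs D hDm hDs τ hτ hτ2
    have h := hΦ H hH β hβ (-β) x y μ₁ ν₁ μ₂ ν₂ s hs D hDm hDs τ hτ hτ2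
    rw [abs_neg, abs_of_pos hβ] at h
    have e : (fun a : LandauFree H → E3 => -(β * phiQuartic H a)) = fun a => -β * phiQuartic H a := funext fun a => by ring
    beta_reduce
    rw [e]
    refine h.trans (le_of_eq ?_)
    rw [show β * (β⁻¹ ^ 4 * (CΦ * (1 + Real.log H) ^ 5 * (1 + Real.sqrt τ * (H : ℝ) ^ 4))) =
        (β * β⁻¹) * (β⁻¹ ^ 3 * (CΦ * (1 + Real.log H) ^ 5 * (1 + Real.sqrt τ * (H : ℝ) ^ 4))) by ring, mul_inv_cancel₀ hβ.ne', one_mul]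
  obtain ⟨q₂, K₂, ⟨β₂, hβ₂, hR₂⟩, hB₂⟩ := rowBound_of_quadSize' hθ hθ' (V := fun (β : ℝ) (H : ℕ) (a : LandauFree H → E3) => -(β * phiQuartic H a)) hVΦ
  refine ⟨max q₁ q₂, fun β H => K₁ β H + K₂ β H, ⟨max β₁ β₂, le_max_of_le_left hβ₁, ?_⟩, ?_⟩
  · intro β hβ H hH hHl hHu D hDm hDs hsym hco hco2 hU x y
    have hb₁ : β₁ ≤ β := (le_max_left _ _).trans hβ
    have hb₂ : β₂ ≤ β := (le_max_right _ _).trans hβ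
    have hβ1 : 1 ≤ β := hβ₁.trans hb₁
    have hβ0 : 0 < β := by linarith
    have hco₁ : gaussAvg β H (fun a => 1 - D.indicator (fun _ => (1 : ℝ)) a) ≤ β ^ (-q₁) :=
      hco.trans (Real.rpow_le_rpow_of_exponent_le hβ1 (neg_le_neg (le_max_left _ _)))
    have hco₂ : gaussAvg β H (fun a => 1 - D.indicator (fun _ => (1 : ℝ)) a) ≤ β ^ (-q₂) :=
      hco.trans (Real.rpow_le_rpow_of_exponent_le hβ1 (neg_le_neg (le_max_right _ _)))
    have h1 := hR₁ β hb₁ H hH hHl hHu D hDm hDs hsym hco₁ hco2 hU x y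
    have h2 := hR₂ β hb₂ H hH hHl hHu D hDm hDs hsym hco₂ hco2 hU x y
    beta_reduce at h2
    -- the split over `μ_D` (fcl-p3 g27): measurability and sup bounds on `D`
    set s : ℝ := β ^ ((1 / 8 - θ / 4) - 1 / 2) with hs
    have hs0 : 0 ≤ s := Real.rpow_nonneg hβ0.le _
    set PT := plaquettesTouching (boxEdges 4 (2 * H + 1)) with hPT
    have hBQ : 0 ≤ B := (abs_nonneg _).trans (hQ 0 0 0 0)
    have m₁ : Measurable fun a : LandauFree H → E3 => -(β * ∑ z ∈ PT, ∑ i : Fin 4, ∑ j : Fin 4, ∑ k : Fin 4, ∑ l : Fin 4, Q i j k l *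
        ((WithLp.ofLp (plaqVar H z.1 z.2.1.1 z.2.1.2 a i) ⬝ᵥ WithLp.ofLp (plaqVar H z.1 z.2.1.1 z.2.1.2 a j)) *
          (WithLp.ofLp (plaqVar H z.1 z.2.1.1 z.2.1.2 a k) ⬝ᵥ WithLp.ofLp (plaqVar H z.1 z.2.1.1 z.2.1.2 a l)))) :=
      (EdgeChartGaussian.measurable_of_polyCert (EdgeChartGaussian.polyCert_quarticPairVertex (H := H) β Q hQ)).neg
    have m₂ : Measurable fun a : LandauFree H → E3 => -(β * phiQuartic H a) := ((PhiQuartic.measurable_phiQuartic H).const_mul β).neg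
    set BV : ℝ := β * PT.card * (256 * B * s ^ 4) + β * (1024 * (H : ℝ) ^ 4 * s ^ 4) with hBV
    have hBV1 : 0 ≤ β * PT.card * (256 * B * s ^ 4) := by positivity
    have hBV2 : 0 ≤ β * (1024 * (H : ℝ) ^ 4 * s ^ 4) := by positivity
    have b₁ : ∀ a ∈ D, |-(β * ∑ z ∈ PT, ∑ i : Fin 4, ∑ j : Fin 4, ∑ k : Fin 4, ∑ l : Fin 4, Q i j k l *
        ((WithLp.ofLp (plaqVar H z.1 z.2.1.1 z.2.1.2 a i) ⬝ᵥ WithLp.ofLp (plaqVar H z.1 z.2.1.1 z.2.1.2 a j)) *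
          (WithLp.ofLp (plaqVar H z.1 z.2.1.1 z.2.1.2 a k) ⬝ᵥ WithLp.ofLp (plaqVar H z.1 z.2.1.1 z.2.1.2 a l))))| ≤ BV := by
      intro a ha
      have hterm : ∀ z ∈ PT, |∑ i : Fin 4, ∑ j : Fin 4, ∑ k : Fin 4, ∑ l : Fin 4, Q i j k l *
          ((WithLp.ofLp (plaqVar H z.1 z.2.1.1 z.2.1.2 a i) ⬝ᵥ WithLp.ofLp (plaqVar H z.1 z.2.1.1 z.2.1.2 a j)) *
            (WithLp.ofLp (plaqVar H z.1 z.2.1.1 z.2.1.2 a k) ⬝ᵥ WithLp.ofLp (plaqVar H z.1 z.2.1.1 z.2.1.2 a l)))| ≤ 256 * B * s ^ 4 := by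
        intro z _
        refine (WilsonTaylor.abs_quarticPairSum_le Q hQ _).trans ?_
        have hS := TiltSup.sum_norm_plaqVar_sq_le hs0 (hDs ha) z.1 z.2.1.1 z.2.1.2
        have hS0 : 0 ≤ ∑ i : Fin 4, ‖plaqVar H z.1 z.2.1.1 z.2.1.2 a i‖ ^ 2 := Finset.sum_nonneg fun i _ => sq_nonneg _
        calc 16 * B * (∑ i : Fin 4, ‖plaqVar H z.1 z.2.1.1 z.2.1.2 a i‖ ^ 2) ^ 2 ≤ 16 * B * (4 * s ^ 2) ^ 2 :=
              mul_le_mul_of_nonneg_left (pow_le_pow_left₀ hS0 hS 2) (by positivity)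
          _ = 256 * B * s ^ 4 := by ring
      have hsum : |∑ z ∈ PT, ∑ i : Fin 4, ∑ j : Fin 4, ∑ k : Fin 4, ∑ l : Fin 4, Q i j k l *
          ((WithLp.ofLp (plaqVar H z.1 z.2.1.1 z.2.1.2 a i) ⬝ᵥ WithLp.ofLp (plaqVar H z.1 z.2.1.1 z.2.1.2 a j)) *
            (WithLp.ofLp (plaqVar H z.1 z.2.1.1 z.2.1.2 a k) ⬝ᵥ WithLp.ofLp (plaqVar H z.1 z.2.1.1 z.2.1.2 a l)))| ≤ PT.card * (256 * B * s ^ 4) := by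
        refine (Finset.abs_sum_le_sum_abs _ _).trans ((Finset.sum_le_sum hterm).trans (le_of_eq ?_))
        rw [Finset.sum_const, nsmul_eq_mul]
      rw [abs_neg, abs_mul, abs_of_pos hβ0, hBV]
      calc β * _ ≤ β * (PT.card * (256 * B * s ^ 4)) := mul_le_mul_of_nonneg_left hsum hβ0.le
        _ = β * PT.card * (256 * B * s ^ 4) := by ring
        _ ≤ _ := le_add_of_nonneg_right hBV2
    have b₂ : ∀ a ∈ D, |-(β * phiQuartic H a)| ≤ BV := by
      intro a ha
      rw [abs_neg, abs_mul, abs_of_pos hβ0, hBV]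
      exact (mul_le_mul_of_nonneg_left (PhiQuartic.abs_phiQuartic_le_of_mem_smallField H (hDs ha)) hβ0.le).trans (le_add_of_nonneg_left hBV1)
    have hsplit := GaussNormalForm.abs_tiltCum3_muSet_linCurvSq_add_third_le H hβ0 hs0 hDm hDs hco2 le_rfl m₁ m₂ b₁ b₂ x y
    have e : (fun a : LandauFree H → E3 => -(β * ∑ z ∈ PT, ∑ i : Fin 4, ∑ j : Fin 4, ∑ k : Fin 4, ∑ l : Fin 4, Q i j k l *
        ((WithLp.ofLp (plaqVar H z.1 z.2.1.1 z.2.1.2 a i) ⬝ᵥ WithLp.ofLp (plaqVar H z.1 z.2.1.1 z.2.1.2 a j)) *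
          (WithLp.ofLp (plaqVar H z.1 z.2.1.1 z.2.1.2 a k) ⬝ᵥ WithLp.ofLp (plaqVar H z.1 z.2.1.1 z.2.1.2 a l)))) - β * phiQuartic H a) =
        fun a => -(β * ∑ z ∈ PT, ∑ i : Fin 4, ∑ j : Fin 4, ∑ k : Fin 4, ∑ l : Fin 4, Q i j k l *
          ((WithLp.ofLp (plaqVar H z.1 z.2.1.1 z.2.1.2 a i) ⬝ᵥ WithLp.ofLp (plaqVar H z.1 z.2.1.1 z.2.1.2 a j)) *
            (WithLp.ofLp (plaqVar H z.1 z.2.1.1 z.2.1.2 a k) ⬝ᵥ WithLp.ofLp (plaqVar H z.1 z.2.1.1 z.2.1.2 a l)))) + -(β * phiQuartic H a) :=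
      funext fun a => by ring
    rw [e]
    exact hsplit.trans (add_le_add h1 h2)
  · intro ε hε
    have hε' : 0 < ε / 2 := half_pos hε
    obtain ⟨b₁, hb₁, e₁⟩ := hB₁ (ε / 2) hε'
    obtain ⟨b₂, hb₂, e₂⟩ := hB₂ (ε / 2) hε'
    refine ⟨max b₁ b₂, le_max_of_le_left hb₁, fun β hβ H hH hHu => ?_⟩
    have h1 := e₁ β ((le_max_left _ _).trans hβ) H hH hHu
    have h2 := e₂ β ((le_max_right _ _).trans hβ) H hH hHu
    have hid : β ^ 2 * (H : ℝ) ^ 8 * (K₁ β H + K₂ β H) = β ^ 2 * (H : ℝ) ^ 8 * K₁ β H + β ^ 2 * (H : ℝ) ^ 8 * K₂ β H := by ring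
    rw [hid]
    linarith

end K3RowSum

end Summit.QuantumFields.YangMills.Theorems.AllWindowsColdBoxBoxHighLine

end
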